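import Summits.CriticalPhenomena.Ising3D.Control2DPolyCert
import Summits.CriticalPhenomena.Ising3D.Control2DTaylorClosedForm
import Summits.CriticalPhenomena.Ising3D.Control2DChiralMono
import Summits.CriticalPhenomena.Ising3D.TaylorQPolyCoeffList
import Summits.CriticalPhenomena.Ising3D.TaylorQPolyParity
import Mathlib.Tactic.Linarith
import Mathlib.Tactic.Positivity
import Mathlib.Tactic.Ring
import Mathlib.Tactic.FieldSimp
import Mathlib.Tactic.LinearCombination
import HarnessLib

/-!
# The cells of a 2D γ-certificate as ONE integer polynomial per spin, and its kernel check
(cell `pub-ising3x`, seat controls-1 gen 15; KERNEL PATH for the 2D γ-certificates, step 3b — CONTROL-ONLY)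

HONEST FRAMING: lottery ticket; floor = tightest certified 3D Ising CFT bounds; no exact-solution
claim without a proof. CONTROL-ONLY (`d = 2`, `Δ_σ = 1/8`); nothing numerical is asserted here.

`gapExcluded_half_of_explicit` reduces a kind-`gap` 2D γ-certificate at `z = z̄ = 1/2` to (I), (R) and
the CELLS `0 ≤ φ[F_-[Q_N(Δ, ℓ)]]`, `φ = taylorFunctional2D (1/2) S w`. Here each cell family becomes the
sign of ONE integer polynomial: `taylorFunctional2D_half_crossF_QN` (any `s`, any table: the value on
the truncated block is SEPARABLE, `(1/2)^{2s+Δ} Σ_p w_p c_p (u_{p₁}(h)u_{p₂}(h̄) + u_{p₁}(h̄)u_{p₂}(h))`,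
`u_k(h) = Σ_{m<N} a_m(h) 2^{-m} q¹(s,h+m;k)`); for `s = 1/8` and an INTEGER table `wt` on an index list
`Sl` the computable lists `qtZ` (`8^k k! q¹`), `ahatZ` (`a_m · D`, `D` = product of the chiral-factor
denominators `2, (i+1)(2h+i)`, never zero for `h ≥ 0` — the unitarity-bound endpoint `h̄ = 0` needs no
special treatment), `uZ`, **`cellPolyZ wt Sl Λ ℓ Nd = P̂_ℓ(y)`** (`y = h̄`) with **`evalR_cellPolyZ`:
`P̂_ℓ((Δ-ℓ)/2) = cellConst · φ[F_-[Q_{Nd+1}(Δ,ℓ)]]`, `cellConst > 0`**, and **`cell_nonneg_of_bernCheck`**: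
a kernel-decided `bernCheck (cellPolyZ …) q a L cs = true` gives `0 ≤ φ[F_-[Q_{Nd+1}(Δ,ℓ)]]` on
`ℓ + 2a/q ≤ Δ ≤ ℓ + 2(a+L)/q`. Measured (RB-1 j105929, Λ=7, E₀=24, N=24: degree 97, ONE Bernstein leaf
per spin): ≈ 30 s kernel per spin. Mirror + independent rational twin: seat folder `work/twin/`.
Elementary; no facts. References: [folklore]; Rattazzi–Rychkov–Tonni–Vichi, JHEP 12 (2008) 031, §5.5.
-/

namespace Summit.CriticalPhenomena.Ising3D.Control2D

open Finset
open Literature.Analysis.ValidatedNumerics.PolyMP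
open Literature.MathematicalPhysics.QuantumFieldTheory.ConformalBootstrap3D

/-- `Σ_{i<n} f i` (coefficientwise). [folklore] -/
def zsumRange (f : ℕ → List ℤ) : ℕ → List ℤ
  | 0 => []
  | n + 1 => zadd (zsumRange f n) (f n)

/-- [folklore] -/
theorem evalR_zsumRange (f : ℕ → List ℤ) (x : ℝ) :
    ∀ n : ℕ, evalR (castZ (zsumRange f n)) x = ∑ i ∈ range n, evalR (castZ (f i)) x
  | 0 => by simp [zsumRange]
  | n + 1 => by rw [zsumRange, evalR_zadd, evalR_zsumRange f x n, sum_range_succ]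

/-- `∏_{i<n} f i`. [folklore] -/
def zprodRange (f : ℕ → List ℤ) : ℕ → List ℤ
  | 0 => [1]
  | n + 1 => zmul (zprodRange f n) (f n)

/-- [folklore] -/
theorem evalR_zprodRange (f : ℕ → List ℤ) (x : ℝ) :
    ∀ n : ℕ, evalR (castZ (zprodRange f n)) x = ∏ i ∈ range n, evalR (castZ (f i)) x
  | 0 => by simp [zprodRange]
  | n + 1 => by rw [zprodRange, evalR_zmul, evalR_zprodRange f x n, prod_range_succ]

/-- `Σ_{a ∈ l} f a` over a list (coefficientwise). [folklore] -/
def zsumList {α : Type*} (l : List α) (f : α → List ℤ) : List ℤ :=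
  l.foldr (fun a acc => zadd (f a) acc) []

/-- [folklore] -/
theorem evalR_zsumList {α : Type*} (f : α → List ℤ) (x : ℝ) :
    ∀ l : List α, evalR (castZ (zsumList l f)) x = (l.map fun a => evalR (castZ (f a)) x).sum
  | [] => by simp [zsumList]
  | a :: l => by
      have h := evalR_zsumList f x l
      simp only [zsumList, List.foldr_cons, List.map_cons, List.sum_cons] at h ⊢
      rw [evalR_zadd, h]

/-- The falling factorial `α(α-1)⋯(α-n+1)` as an integer list (mirror of `descPochList`). [folklore] -/
def descPochZ : ℕ → List ℤ
  | 0 => [1]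
  | n + 1 => zmul (descPochZ n) [-(n : ℤ), 1]

/-- [folklore] -/
theorem evalR_descPochZ : ∀ (n : ℕ) (α : ℝ),
    evalR (castZ (descPochZ n)) α = (descPochhammer ℝ n).eval α
  | 0, α => by simp [descPochZ]
  | n + 1, α => by
      rw [descPochZ, evalR_zmul, evalR_descPochZ n α, descPochhammer_succ_eval]
      simp only [castZ_cons, castZ_nil, evalR_cons, evalR_nil, Int.cast_neg, Int.cast_natCast,
        Int.cast_one]
      ring

/-- `∏_{j<i} (1 - 8j) = 8^i · (1/8)(1/8 - 1)⋯(1/8 - i + 1)`. [folklore] -/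
def chooseZ8 : ℕ → ℤ
  | 0 => 1
  | i + 1 => chooseZ8 i * (1 - 8 * (i : ℤ))

/-- [folklore] -/
theorem cast_chooseZ8 : ∀ i : ℕ,
    (chooseZ8 i : ℝ) = 8 ^ i * (descPochhammer ℝ i).eval (1 / 8 : ℝ)
  | 0 => by simp [chooseZ8]
  | i + 1 => by
      rw [chooseZ8, Int.cast_mul, cast_chooseZ8 i, descPochhammer_succ_eval]
      push_cast
      ring

/-- `Q̃_k(α) := 8^k k! q¹(1/8, α; k) = Σ_i (-1)^i [∏_{j<i}(1-8j)] 8^{k-i} C(k,i) · α(α-1)⋯(α-k+i+1)`, an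
integer coefficient list in `α`. [folklore] -/
def qtZ (k : ℕ) : List ℤ :=
  zsumRange (fun i => zsmul ((-1) ^ i * chooseZ8 i * 8 ^ (k - i) * (Nat.choose k i : ℤ))
    (descPochZ (k - i))) (k + 1)

/-- **`Q̃_k(α) = 8^k · k! · q¹(1/8, α; k)`.** [folklore] -/
theorem evalR_qtZ (k : ℕ) (α : ℝ) :
    evalR (castZ (qtZ k)) α = 8 ^ k * (k.factorial : ℝ) * qFactor₁ (1 / 8) α k := by
  rw [qtZ, evalR_zsumRange, qFactor₁, Finset.Nat.sum_antidiagonal_eq_sum_range_succ_mk,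
    Finset.mul_sum]
  refine Finset.sum_congr rfl fun i hi => ?_
  have hik : i ≤ k := Nat.lt_succ_iff.mp (Finset.mem_range.mp hi)
  rw [evalR_zsmul, evalR_descPochZ, choose_eq_descPochhammer_div, choose_eq_descPochhammer_div]
  push_cast
  rw [cast_chooseZ8]
  have hfac : ((Nat.choose k i : ℕ) : ℝ) * (i.factorial : ℝ) * ((k - i).factorial : ℝ) =
      (k.factorial : ℝ) := by
    exact_mod_cast Nat.choose_mul_factorial_mul_factorial hik
  have hi0 : (i.factorial : ℝ) ≠ 0 := by positivity
  have hki0 : ((k - i).factorial : ℝ) ≠ 0 := by positivity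
  have h8 : (8 : ℝ) ^ k = 8 ^ i * 8 ^ (k - i) := by rw [← pow_add, Nat.add_sub_cancel' hik]
  field_simp
  rw [h8, ← hfac]
  ring

/-- Numerator of the `i`-th chiral factor at `h = y + c`: `h` (`i = 0`), `(h+i)²` (`i ≥ 1`). [folklore] -/
def numZ (c i : ℕ) : List ℤ :=
  if i = 0 then [(c : ℤ), 1] else zmul [((c + i : ℕ) : ℤ), 1] [((c + i : ℕ) : ℤ), 1]

/-- Denominator of the `i`-th chiral factor at `h = y + c`: `2` (`i = 0`), `(i+1)(2h+i)` (`i ≥ 1`).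
[folklore] -/
def denZ (c i : ℕ) : List ℤ :=
  if i = 0 then [2] else [(((i + 1) * (2 * c + i) : ℕ) : ℤ), ((2 * (i + 1) : ℕ) : ℤ)]

/-- [folklore] -/
theorem evalR_numZ (c i : ℕ) (y : ℝ) :
    evalR (castZ (numZ c i)) y = if i = 0 then y + c else (y + c + i) ^ 2 := by
  unfold numZ; split_ifs with h
  · simp; ring
  · rw [evalR_zmul]; simp; ring

/-- [folklore] -/
theorem evalR_denZ (c i : ℕ) (y : ℝ) :
    evalR (castZ (denZ c i)) y = if i = 0 then 2 else ((i : ℝ) + 1) * (2 * (y + c) + i) := by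
  unfold denZ
  split_ifs with h <;> simp; ring

/-- The chiral factor is `num / den` at `h = y + c`. [folklore] -/
theorem chiralFactor_eq_numZ_div_denZ (c i : ℕ) (y : ℝ) :
    chiralFactor i (y + c) = evalR (castZ (numZ c i)) y / evalR (castZ (denZ c i)) y := by
  rw [evalR_numZ, evalR_denZ, chiralFactor]
  split_ifs <;> simp

/-- `den > 0` for `y + c ≥ 0`. [folklore] -/
theorem evalR_denZ_pos (c i : ℕ) {y : ℝ} (hy : 0 ≤ y + c) : 0 < evalR (castZ (denZ c i)) y := by
  rw [evalR_denZ]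
  split_ifs <;> [norm_num; positivity]

/-- The common denominator `D(y) = ∏_{i<Nd} den_i(y + c)`. [folklore] -/
noncomputable def denProd (Nd c : ℕ) (y : ℝ) : ℝ := ∏ i ∈ range Nd, evalR (castZ (denZ c i)) y

/-- [folklore] -/
theorem denProd_pos (Nd c : ℕ) {y : ℝ} (hy : 0 ≤ y + c) : 0 < denProd Nd c y :=
  prod_pos fun i _ => evalR_denZ_pos c i hy

/-- `Â_m = ∏_{i<m} num_i · ∏_{m ≤ i < Nd} den_i` as an integer list in `y`. [folklore] -/
def ahatZ (Nd c m : ℕ) : List ℤ :=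
  zmul (zprodRange (numZ c) m) (zprodRange (fun j => denZ c (m + j)) (Nd - m))

/-- **`Â_m(y) = a_m(y + c) · D(y)`** for `y + c ≥ 0`, `m ≤ Nd` (`a_m = chiralCoeff`). [folklore] -/
theorem evalR_ahatZ {Nd c m : ℕ} (hm : m ≤ Nd) {y : ℝ} (hy : 0 ≤ y + c) :
    evalR (castZ (ahatZ Nd c m)) y = chiralCoeff (y + c) m * denProd Nd c y := by
  rw [ahatZ, evalR_zmul, evalR_zprodRange, evalR_zprodRange, chiralCoeff_eq_prod hy, chiralProd,
    denProd]
  have hsplit : ∏ i ∈ range Nd, evalR (castZ (denZ c i)) y =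
      (∏ i ∈ range m, evalR (castZ (denZ c i)) y) *
        ∏ j ∈ range (Nd - m), evalR (castZ (denZ c (m + j))) y := by
    rw [← prod_range_add, Nat.add_sub_cancel' hm]
  rw [hsplit, ← mul_assoc]
  congr 1
  rw [Finset.prod_congr rfl fun i _ => chiralFactor_eq_numZ_div_denZ c i y, prod_div_distrib,
    div_mul_cancel₀]
  exact (prod_pos fun i _ => evalR_denZ_pos c i hy).ne'

/-- The analytic one-sided sum `u_k(h) = Σ_{m<N} a_m(h) (1/2)^m q¹(s, h+m; k)`. [folklore] -/
noncomputable def uSum (s : ℝ) (N : ℕ) (h : ℝ) (k : ℕ) : ℝ :=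
  ∑ m ∈ range N, chiralCoeff h m * (1 / 2 : ℝ) ^ m * qFactor₁ s (h + m) k

/-- `U_k(y) = Σ_{m ≤ Nd} 2^{Nd-m} Â_m(y) Q̃_k(y + c + m)` as an integer list in `y`. [folklore] -/
def uZ (Nd c k : ℕ) : List ℤ :=
  zsumRange (fun m => zsmul (2 ^ (Nd - m)) (zmul (ahatZ Nd c m) (zshift (qtZ k) ((c + m : ℕ) : ℤ))))
    (Nd + 1)

/-- **`U_k(y) = 2^{Nd} · D(y) · 8^k k! · u_k(y + c)`** for `y + c ≥ 0` (with `N = Nd + 1`, `s = 1/8`).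
[folklore] -/
theorem evalR_uZ (Nd c k : ℕ) {y : ℝ} (hy : 0 ≤ y + c) :
    evalR (castZ (uZ Nd c k)) y =
      2 ^ Nd * denProd Nd c y * (8 ^ k * (k.factorial : ℝ)) * uSum (1 / 8) (Nd + 1) (y + c) k := by
  rw [uZ, evalR_zsumRange, uSum, Finset.mul_sum]
  refine Finset.sum_congr rfl fun m hm => ?_
  have hmN : m ≤ Nd := Nat.lt_succ_iff.mp (Finset.mem_range.mp hm)
  rw [evalR_zsmul, evalR_zmul, evalR_ahatZ hmN hy, evalR_zshift, evalR_qtZ]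
  have h2 : ((2 ^ (Nd - m) : ℤ) : ℝ) = 2 ^ Nd * (1 / 2 : ℝ) ^ m := by
    have : (2 : ℝ) ^ Nd = 2 ^ (Nd - m) * 2 ^ m := by rw [← pow_add, Nat.sub_add_cancel hmN]
    push_cast
    rw [this, one_div_pow, mul_assoc, mul_one_div_cancel (pow_ne_zero m two_ne_zero), mul_one]
  have hc : (((c + m : ℕ) : ℤ) : ℝ) + y = y + c + m := by push_cast; ring
  rw [h2, hc]
  ring

/-- The parity weight `(1 - (-1)^{p₁+p₂}) 2^{p₁+p₂}` of a table entry. [folklore] -/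
noncomputable def cfac (p : ℕ × ℕ) : ℝ := (1 - (-1 : ℝ) ^ (p.1 + p.2)) * 2 ^ (p.1 + p.2)

/-- **The table functional on the truncated block at `(1/2,1/2)`, separable form**:
`φ[F_-[Q_N]] = (1/2)^{2s} (1/2)^Δ Σ_p w_p c_p (u_{p₁}(h) u_{p₂}(h̄) + u_{p₁}(h̄) u_{p₂}(h))`,
`h = (Δ+ℓ)/2`, `h̄ = (Δ-ℓ)/2` (`ℓ ≤ Δ`). [folklore] -/
theorem taylorFunctional2D_half_crossF_QN (S : Finset (ℕ × ℕ)) (w : ℕ × ℕ → ℝ) (s : ℝ) {Δ : ℝ}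
    {ℓ : ℕ} (hΔ : (ℓ : ℝ) ≤ Δ) (N : ℕ) :
    taylorFunctional2D (1 / 2) S w (crossF s (-1) (QN N ℓ Δ)) =
      (1 / 2 : ℝ) ^ s * (1 / 2 : ℝ) ^ s * (1 / 2 : ℝ) ^ Δ *
        ∑ p ∈ S, w p * cfac p *
          (uSum s N ((Δ + ℓ) / 2) p.1 * uSum s N ((Δ - ℓ) / 2) p.2 +
            uSum s N ((Δ - ℓ) / 2) p.1 * uSum s N ((Δ + ℓ) / 2) p.2) := by
  rw [taylorFunctional2D_crossF_QN (by norm_num) (by norm_num) S w s hΔ N]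
  set h : ℝ := (Δ + ℓ) / 2 with hh
  set hb : ℝ := (Δ - ℓ) / 2 with hhb
  have hΔh : Δ = h + hb := by rw [hh, hhb]; ring
  have hhalf : (0 : ℝ) < 1 / 2 := by norm_num
  set C : ℝ := (1 / 2 : ℝ) ^ s * (1 / 2 : ℝ) ^ s * (1 / 2 : ℝ) ^ Δ with hC
  -- the common summand
  set T : ℕ → ℕ → ℕ × ℕ → ℝ := fun m m' p =>
    C * (w p * cfac p *
      ((chiralCoeff h m * (1 / 2 : ℝ) ^ m * qFactor₁ s (h + m) p.1) *
          (chiralCoeff hb m' * (1 / 2 : ℝ) ^ m' * qFactor₁ s (hb + m') p.2) +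
        (chiralCoeff hb m' * (1 / 2 : ℝ) ^ m' * qFactor₁ s (hb + m') p.1) *
          (chiralCoeff h m * (1 / 2 : ℝ) ^ m * qFactor₁ s (h + m) p.2))) with hT
  have key : ∀ (m m' : ℕ) (p : ℕ × ℕ),
      chiralCoeff h m * chiralCoeff hb m' *
        (w p * (factor₁Germ s (h + m) (1 / 2) p.1 * factor₁Germ s (hb + m') (1 / 2) p.2 +
              factor₁Germ s (hb + m') (1 / 2) p.1 * factor₁Germ s (h + m) (1 / 2) p.2 +
            (-1) * (factor₂Germ s (h + m) (1 / 2) p.1 * factor₂Germ s (hb + m') (1 / 2) p.2 +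
              factor₂Germ s (hb + m') (1 / 2) p.1 * factor₂Germ s (h + m) (1 / 2) p.2))) =
      T m m' p := by
    intro m m' p
    simp only [hT, hC, factor₁Germ_half, factor₂Germ_half, qFactor₂_eq, cfac]
    rw [Real.rpow_add_natCast hhalf.ne', Real.rpow_add_natCast hhalf.ne', hΔh,
      Real.rpow_add hhalf, pow_add]
    ring
  have hL : ∑ m ∈ range N, ∑ m' ∈ range N, chiralCoeff h m * chiralCoeff hb m' *
      ∑ p ∈ S, w p * (factor₁Germ s (h + m) (1 / 2) p.1 * factor₁Germ s (hb + m') (1 / 2) p.2 +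
              factor₁Germ s (hb + m') (1 / 2) p.1 * factor₁Germ s (h + m) (1 / 2) p.2 +
            (-1) * (factor₂Germ s (h + m) (1 / 2) p.1 * factor₂Germ s (hb + m') (1 / 2) p.2 +
              factor₂Germ s (hb + m') (1 / 2) p.1 * factor₂Germ s (h + m) (1 / 2) p.2)) =
      ∑ m ∈ range N, ∑ m' ∈ range N, ∑ p ∈ S, T m m' p := by
    refine sum_congr rfl fun m _ => sum_congr rfl fun m' _ => ?_
    rw [Finset.mul_sum]
    exact sum_congr rfl fun p _ => key m m' p
  have hR : C * ∑ p ∈ S, w p * cfac p *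
        (uSum s N h p.1 * uSum s N hb p.2 + uSum s N hb p.1 * uSum s N h p.2) =
      ∑ p ∈ S, ∑ m ∈ range N, ∑ m' ∈ range N, T m m' p := by
    rw [Finset.mul_sum]
    refine sum_congr rfl fun p _ => ?_
    have h1 : uSum s N h p.1 * uSum s N hb p.2 = ∑ m ∈ range N, ∑ m' ∈ range N,
        (chiralCoeff h m * (1 / 2 : ℝ) ^ m * qFactor₁ s (h + m) p.1) *
          (chiralCoeff hb m' * (1 / 2 : ℝ) ^ m' * qFactor₁ s (hb + m') p.2) := by
      rw [uSum, uSum, sum_mul_sum]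
    have h2 : uSum s N hb p.1 * uSum s N h p.2 = ∑ m ∈ range N, ∑ m' ∈ range N,
        (chiralCoeff hb m' * (1 / 2 : ℝ) ^ m' * qFactor₁ s (hb + m') p.1) *
          (chiralCoeff h m * (1 / 2 : ℝ) ^ m * qFactor₁ s (h + m) p.2) := by
      rw [uSum, uSum, sum_mul_sum, sum_comm]
    rw [h1, h2, ← sum_add_distrib, Finset.mul_sum, Finset.mul_sum]
    refine sum_congr rfl fun m _ => ?_
    rw [← sum_add_distrib, Finset.mul_sum, Finset.mul_sum]
  rw [hL, hR]
  calc ∑ m ∈ range N, ∑ m' ∈ range N, ∑ p ∈ S, T m m' p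
      = ∑ m ∈ range N, ∑ p ∈ S, ∑ m' ∈ range N, T m m' p :=
        sum_congr rfl fun m _ => sum_comm
    _ = ∑ p ∈ S, ∑ m ∈ range N, ∑ m' ∈ range N, T m m' p := sum_comm

/-- The integer weight `ω_p = ŵ_p · c_p · 8^{Λ-p₁-p₂} (Λ!/p₁!) (Λ!/p₂!)` of a table entry. [folklore] -/
def omegaZ (Λ : ℕ) (wt : ℕ × ℕ → ℤ) (p : ℕ × ℕ) : ℤ :=
  wt p * ((1 - (-1) ^ (p.1 + p.2)) * 2 ^ (p.1 + p.2)) * 8 ^ (Λ - p.1 - p.2) *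
    ((Λ.factorial : ℤ) / (p.1.factorial : ℤ)) * ((Λ.factorial : ℤ) / (p.2.factorial : ℤ))

/-- [folklore] -/
theorem cast_omegaZ {Λ : ℕ} (wt : ℕ × ℕ → ℤ) {p : ℕ × ℕ} (hp : p.1 + p.2 ≤ Λ) :
    (omegaZ Λ wt p : ℝ) * (8 ^ p.1 * (p.1.factorial : ℝ)) * (8 ^ p.2 * (p.2.factorial : ℝ)) =
      (wt p : ℝ) * cfac p * (8 ^ Λ * (Λ.factorial : ℝ) * (Λ.factorial : ℝ)) := by
  obtain ⟨h1, h2⟩ : p.1 ≤ Λ ∧ p.2 ≤ Λ := ⟨by omega, by omega⟩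
  have hd1Z : ((Λ.factorial : ℤ) / (p.1.factorial : ℤ)) * (p.1.factorial : ℤ) = Λ.factorial :=
    Int.ediv_mul_cancel (Int.natCast_dvd_natCast.mpr (Nat.factorial_dvd_factorial h1))
  have hd2Z : ((Λ.factorial : ℤ) / (p.2.factorial : ℤ)) * (p.2.factorial : ℤ) = Λ.factorial :=
    Int.ediv_mul_cancel (Int.natCast_dvd_natCast.mpr (Nat.factorial_dvd_factorial h2))
  have hd1 : (((Λ.factorial : ℤ) / (p.1.factorial : ℤ) : ℤ) : ℝ) * (p.1.factorial : ℝ) =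
      Λ.factorial := by exact_mod_cast hd1Z
  have hd2 : (((Λ.factorial : ℤ) / (p.2.factorial : ℤ) : ℤ) : ℝ) * (p.2.factorial : ℝ) =
      Λ.factorial := by exact_mod_cast hd2Z
  have h8 : (8 : ℝ) ^ Λ = 8 ^ (Λ - p.1 - p.2) * 8 ^ p.1 * 8 ^ p.2 := by
    rw [← pow_add, ← pow_add]; congr 1; omega
  unfold omegaZ cfac
  simp only [Int.cast_mul, Int.cast_pow, Int.cast_sub, Int.cast_one, Int.cast_neg, Int.cast_ofNat]
  linear_combination ((wt p : ℝ) * ((1 - (-1 : ℝ) ^ (p.1 + p.2)) * 2 ^ (p.1 + p.2))) *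
      ((8 : ℝ) ^ (Λ - p.1 - p.2) * 8 ^ p.1 * 8 ^ p.2) *
      (((((Λ.factorial : ℤ) / (p.2.factorial : ℤ) : ℤ) : ℝ) * (p.2.factorial : ℝ)) * hd1 +
        (Λ.factorial : ℝ) * hd2) -
    ((wt p : ℝ) * ((1 - (-1 : ℝ) ^ (p.1 + p.2)) * 2 ^ (p.1 + p.2))) *
      ((Λ.factorial : ℝ) * (Λ.factorial : ℝ)) * h8

/-- **The integer cell polynomial** `P̂_ℓ(y) = Σ_{p ∈ Sl} ω_p (U^{(ℓ)}_{p₁} U^{(0)}_{p₂} + U^{(0)}_{p₁} U^{(ℓ)}_{p₂})`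
of a table (`wt` on the index list `Sl`), spin `ℓ`, truncation `Nd` (`N = Nd + 1` levels), in the
variable `y = h̄ = (Δ-ℓ)/2`. Computable; this is what the kernel evaluates. [folklore] -/
def cellPolyZ (wt : ℕ × ℕ → ℤ) (Sl : List (ℕ × ℕ)) (Λ ℓ Nd : ℕ) : List ℤ :=
  zsumList Sl fun p => zsmul (omegaZ Λ wt p)
    (zadd (zmul (uZ Nd ℓ p.1) (uZ Nd 0 p.2)) (zmul (uZ Nd 0 p.1) (uZ Nd ℓ p.2)))

/-- The positive factor relating `P̂_ℓ` to the functional value. [folklore] -/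
noncomputable def cellConst (Λ ℓ Nd : ℕ) (Δ : ℝ) : ℝ :=
  8 ^ Λ * (Λ.factorial : ℝ) * (Λ.factorial : ℝ) * (4 : ℝ) ^ Nd *
    denProd Nd ℓ ((Δ - ℓ) / 2) * denProd Nd 0 ((Δ - ℓ) / 2) *
      ((1 / 2 : ℝ) ^ (1 / 8 : ℝ) * (1 / 2 : ℝ) ^ (1 / 8 : ℝ) * (1 / 2 : ℝ) ^ Δ)⁻¹

/-- [folklore] -/
theorem cellConst_pos (Λ ℓ Nd : ℕ) {Δ : ℝ} (hΔ : (ℓ : ℝ) ≤ Δ) : 0 < cellConst Λ ℓ Nd Δ := by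
  unfold cellConst
  have h1 : 0 < denProd Nd ℓ ((Δ - ℓ) / 2) := denProd_pos Nd ℓ (by linarith)
  have h2 : 0 < denProd Nd 0 ((Δ - ℓ) / 2) := denProd_pos Nd 0 (by push_cast; linarith)
  have h3 : (0 : ℝ) < (1 / 2 : ℝ) ^ (1 / 8 : ℝ) := Real.rpow_pos_of_pos (by norm_num) _
  have h4 : (0 : ℝ) < (1 / 2 : ℝ) ^ Δ := Real.rpow_pos_of_pos (by norm_num) _
  positivity

/-- **Meaning of the cell polynomial**: for the integer table `wt` on the duplicate-free index list
`Sl` (all `p₁ + p₂ ≤ Λ`) and `ℓ ≤ Δ`,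
`P̂_ℓ((Δ-ℓ)/2) = cellConst · taylorFunctional2D (1/2) Sl.toFinset (wt ·) (F^{1/8}_-[Q_{Nd+1}(Δ, ℓ)])`.
[folklore] -/
theorem evalR_cellPolyZ (wt : ℕ × ℕ → ℤ) {Sl : List (ℕ × ℕ)} (hnd : Sl.Nodup) {Λ : ℕ}
    (hΛ : ∀ p ∈ Sl, p.1 + p.2 ≤ Λ) (ℓ Nd : ℕ) {Δ : ℝ} (hΔ : (ℓ : ℝ) ≤ Δ) :
    evalR (castZ (cellPolyZ wt Sl Λ ℓ Nd)) ((Δ - ℓ) / 2) =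
      cellConst Λ ℓ Nd Δ *
        taylorFunctional2D (1 / 2) Sl.toFinset (fun p => (wt p : ℝ))
          (crossF (1 / 8) (-1) (QN (Nd + 1) ℓ Δ)) := by
  set y : ℝ := (Δ - ℓ) / 2 with hy
  have hyℓ : 0 ≤ y + (ℓ : ℕ) := by rw [hy]; linarith
  have hy0 : 0 ≤ y + ((0 : ℕ) : ℝ) := by rw [hy]; push_cast; linarith
  have hh : y + (ℓ : ℕ) = (Δ + ℓ) / 2 := by rw [hy]; ring
  have hhb : y + ((0 : ℕ) : ℝ) = y := by push_cast; ring
  set K : ℝ := 8 ^ Λ * (Λ.factorial : ℝ) * (Λ.factorial : ℝ) * (4 : ℝ) ^ Nd *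
    denProd Nd ℓ y * denProd Nd 0 y with hK
  have hC : ((1 / 2 : ℝ) ^ (1 / 8 : ℝ) * (1 / 2 : ℝ) ^ (1 / 8 : ℝ) * (1 / 2 : ℝ) ^ Δ) ≠ 0 := by
    have h3 : (0 : ℝ) < (1 / 2 : ℝ) ^ (1 / 8 : ℝ) := Real.rpow_pos_of_pos (by norm_num) _
    have h4 : (0 : ℝ) < (1 / 2 : ℝ) ^ Δ := Real.rpow_pos_of_pos (by norm_num) _
    positivity
  have hKC : cellConst Λ ℓ Nd Δ *
      ((1 / 2 : ℝ) ^ (1 / 8 : ℝ) * (1 / 2 : ℝ) ^ (1 / 8 : ℝ) * (1 / 2 : ℝ) ^ Δ) = K := by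
    rw [cellConst, hK, mul_assoc, inv_mul_cancel₀ hC, mul_one]
  rw [taylorFunctional2D_half_crossF_QN _ _ _ hΔ, List.sum_toFinset _ hnd, cellPolyZ,
    evalR_zsumList, ← mul_assoc, hKC, ← List.sum_map_mul_left]
  congr 1
  refine List.map_congr_left fun p hp => ?_
  rw [evalR_zsmul, evalR_zadd, evalR_zmul, evalR_zmul, evalR_uZ Nd ℓ p.1 hyℓ,
    evalR_uZ Nd 0 p.2 hy0, evalR_uZ Nd 0 p.1 hy0, evalR_uZ Nd ℓ p.2 hyℓ, hh, hhb]
  have hω := cast_omegaZ wt (hΛ p hp)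
  have h4 : (4 : ℝ) ^ Nd = 2 ^ Nd * 2 ^ Nd := by rw [← mul_pow]; norm_num
  rw [hK, h4]
  linear_combination (2 ^ Nd * denProd Nd ℓ y * (2 ^ Nd * denProd Nd 0 y) *
    (uSum (1 / 8) (Nd + 1) ((Δ + ℓ) / 2) p.1 * uSum (1 / 8) (Nd + 1) y p.2 +
      uSum (1 / 8) (Nd + 1) y p.1 * uSum (1 / 8) (Nd + 1) ((Δ + ℓ) / 2) p.2)) * hω

/-- **Sign transfer**: `P̂_ℓ((Δ-ℓ)/2) ≥ 0 ⇒ φ[F_-[Q_{Nd+1}(Δ,ℓ)]] ≥ 0` (`ℓ ≤ Δ`). [folklore] -/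
theorem cell_nonneg_of_evalR_nonneg (wt : ℕ × ℕ → ℤ) {Sl : List (ℕ × ℕ)} (hnd : Sl.Nodup) {Λ : ℕ}
    (hΛ : ∀ p ∈ Sl, p.1 + p.2 ≤ Λ) (ℓ Nd : ℕ) {Δ : ℝ} (hΔ : (ℓ : ℝ) ≤ Δ)
    (h : 0 ≤ evalR (castZ (cellPolyZ wt Sl Λ ℓ Nd)) ((Δ - ℓ) / 2)) :
    0 ≤ taylorFunctional2D (1 / 2) Sl.toFinset (fun p => (wt p : ℝ))
      (crossF (1 / 8) (-1) (QN (Nd + 1) ℓ Δ)) := by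
  rw [evalR_cellPolyZ wt hnd hΛ ℓ Nd hΔ] at h
  exact (mul_nonneg_iff_of_pos_left (cellConst_pos Λ ℓ Nd hΔ)).mp h

/-- **A cell of a 2D γ-certificate from a Bernstein certificate** (the theorem the per-spin data files
instantiate): if `bernCheck (cellPolyZ wt Sl Λ ℓ Nd) q a L cs = true` with `q > 0`, `a ≥ 0`, `L ≥ 0`,
then `φ[F_-[Q_{Nd+1}(Δ, ℓ)]] ≥ 0` for every `Δ` with `ℓ + 2a/q ≤ Δ ≤ ℓ + 2(a+L)/q`
(`φ = taylorFunctional2D (1/2) Sl.toFinset wt`, `Δ_σ = 1/8`). [folklore] -/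
theorem cell_nonneg_of_bernCheck (wt : ℕ × ℕ → ℤ) {Sl : List (ℕ × ℕ)} (hnd : Sl.Nodup) {Λ : ℕ}
    (hΛ : ∀ p ∈ Sl, p.1 + p.2 ≤ Λ) (ℓ Nd : ℕ) {q a L : ℤ} {cs : List ℤ} (hq : 0 < q) (ha : 0 ≤ a)
    (hL : 0 ≤ L) (hchk : bernCheck (cellPolyZ wt Sl Λ ℓ Nd) q a L cs = true) {Δ : ℝ}
    (hlo : (ℓ : ℝ) + 2 * a / q ≤ Δ) (hhi : Δ ≤ (ℓ : ℝ) + 2 * ((a : ℝ) + L) / q) :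
    0 ≤ taylorFunctional2D (1 / 2) Sl.toFinset (fun p => (wt p : ℝ))
      (crossF (1 / 8) (-1) (QN (Nd + 1) ℓ Δ)) := by
  have hqR : (0 : ℝ) < q := by exact_mod_cast hq
  have haq : 0 ≤ 2 * (a : ℝ) / q := by positivity
  refine cell_nonneg_of_evalR_nonneg wt hnd hΛ ℓ Nd (by linarith) ?_
  have e1 : 2 * (a : ℝ) / q = 2 * ((a : ℝ) / q) := by ring
  have e2 : 2 * ((a : ℝ) + L) / q = 2 * (((a : ℝ) + L) / q) := by ring
  exact evalR_nonneg_of_bernCheck hq hL hchk (by linarith) (by linarith)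

end Summit.CriticalPhenomena.Ising3D.Control2D
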